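import Mathlib
import Literature.AlgebraicGeometry.Resolution.RegularHomReduced
import Literature.AlgebraicGeometry.Resolution.AdicQuotient
import Literature.AlgebraicGeometry.Resolution.AdicCompletionRegular
import Literature.AlgebraicGeometry.Resolution.FormalBranchesLocal
import Literature.AlgebraicGeometry.Resolution.RegularLocalRingsQuotient
import Literature.AlgebraicGeometry.Resolution.RegularLocalRingsUFD
import Literature.AlgebraicGeometry.Resolution.ExcellentClosedSubschemes
import Literature.AlgebraicGeometry.Resolution.ExcellentRingsEssFiniteType
import HarnessLib

/-!
# The e.f.t. local weighted game (door `HypersurfaceCentreConstruction`): termination of steepening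

Topic: `Summits/ResolutionOfSingularities/ResolutionOfSingularities/Theorems`. Helper for the door item
`HypersurfaceCentreConstruction` (statement `stmt-ResolutionOfSingularities-19897`, route `WeightedInvariant`),
line `local-engine` of `res-L1-w43-plan-1` (L W4.3), ORDER (o13) «the `dim S = 2` rung of H2a′
`LocalWeightedDropEFT p`» held by res-type-098: this file is kernel **K6 = L∞** of res-type-098's design memo
`L/res-type-098-w43/EFT-DIM2-DESIGN.md` (sha16 `57346d14bde74e12`, §3 «the one hard case is TERMINATION OF
STEEPENING = algebraization of maximal contact», §4 table row K6 «THE crux of the rung»), written by the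
reserve hand res-type-078 (second hand on (o13), STATUS 2026-08-27T06:16:12Z).

[OURS · L1 W4.3] Replaces the role of NO printed item; NOT a statement of the manuscript
[claim: Hironaka2017, status: under-review]. AI work, weaker than expert review.

## Statements proved (K5-free, valid in every dimension; no definitions)

Let `S` be an EXCELLENT regular local ring (e.g. essentially of finite type over a field) and let
`y₀, y₁, …` be elements of `𝔪 ∖ 𝔪²` with `y_{k+1} - y_k ∈ 𝔪^{b_k}` for a strictly increasing `b : ℕ → ℕ`
(the successive STEEPENINGS `y ↦ y - λ̃ x^b` of the memo's case D′ have `y_{k+1} - y_k ∈ (x^{b_k})`, `x ∈ 𝔪`).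
If `1 ≤ ν`, `f ∉ 𝔪^{ν+1}` and `f ∈ (y_k^ν) + 𝔪^{b_k}` for EVERY `k` (case D′ for ever: `f ∈ (y_k^ν, x^{b_k})`,
the Newton polygon of `f` in the coordinates `(x, y_k)` has first slope `≥ b_k`), then `f = unit · π^ν` for some
`π ∈ 𝔪 ∖ 𝔪²`:

* `exists_associated_pow_of_adicSteepening` — the `𝔪`-adic form just stated (res-type-098's wish (w2));
* `exists_associated_pow_of_steepening` — the form with `x ∈ 𝔪`, `y_{k+1} - y_k ∈ (x^{b_k})`,
  `f ∈ (y_k^ν, x^{b_k})` (the signature announced on STATUS 2026-08-27T06:16:12Z, accepted by res-type-098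
  06:26:38Z as «EXACTLY what my assembly consumes»);
* `exists_mem_span_pow_of_steepening` / `exists_pow_dvd_of_adicSteepening` — the same with conclusion
  `f ∈ (π^ν)` / `π^ν ∣ f` (wish (w1));
* `exists_associated_pow_of_steepening_of_essFiniteType` — the binder `[Algebra.EssFiniteType k₀ S]` of the
  door's positions instead of `IsExcellentRing S` (tree `IsExcellentRing.of_essFiniteType`).

So an infinite run of D′ is case A of the memo (a `ν`-fold regular factor, `π² ∣ f` once `ν ≥ 2`) — the
dimension-two game needs no recursion on the invariant, only excellence.  Tools exported on the way:
`mem_of_forall_mem_sup_pow` (ideals of a Noetherian local ring are `𝔪`-adically closed),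
`comap_maximalIdeal_pow_adicCompletion` (`𝔪_Ŝ^n ∩ S = 𝔪^n`), `exists_limit` / `exists_limit_of_steepening`
(limits of `𝔪`-adic Cauchy sequences in `Ŝ = AdicCompletion 𝔪 S`), `exists_prime_dvd_mem_of_mem` (UFD).

## Proof (memo §3, made kernel; no heights, no dimension hypothesis)

In `Ŝ = AdicCompletion 𝔪 S` (regular local, faithfully flat over `S`) the `y_k` converge to `ŷ ∈ 𝔪̂ ∖ 𝔪̂²`
with `ŷ - y_k ∈ 𝔪̂^k` (`exists_limit_of_steepening`); hence `f ∈ (ŷ^ν) + 𝔪̂^k` for all `k`, so `f ∈ ŷ^ν Ŝ`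
(ideals of a Noetherian local ring are closed, `mem_of_forall_mem_sup_pow`) and `f = c ŷ^ν` with `c` a unit
because `𝔪̂^{ν+1} ∩ S = 𝔪^{ν+1}`.  `ŷ` is a prime element of the regular local ring `Ŝ`; the prime
`Q = ŷŜ ∩ S ∋ f` contains a prime factor `π` of `f` (`S` is a UFD).  `S/(π)` is an excellent local domain, so
`Ŝ/πŜ ≅ (S/(π))^` is reduced (completion commutes with quotients; excellent reduced local rings are
analytically unramified): `πŜ` is radical.  Now `π ∈ ŷŜ` and `ŷ^ν ∈ fŜ ⊆ πŜ`, so `πŜ = ŷŜ`; therefore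
`π ∉ 𝔪²`, `fŜ = π^ν Ŝ`, and `(f) = (π^ν)` in `S` by faithful flatness.

## References

* H. Matsumura, *Commutative Ring Theory*, Thms. 8.11, 14.3, 20.3, §32. [Matsumura1987]
* The Stacks Project, Tags 07QK, 07QV (quasi-excellent local rings are analytically unramified). [StacksProject]
-/

noncomputable section

open IsLocalRing Literature.AlgebraicGeometry.Resolution

set_option linter.dupNamespace false -- mandated namespace of this single-conjunct summit

namespace Summit.ResolutionOfSingularities.ResolutionOfSingularities.Theorems

namespace LocalGameEFTContact

universe u

/-! ### Ideals of a Noetherian local ring are adically closed -/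

/-- Krull: in a Noetherian local ring `T`, if `g ∈ J + 𝔪^k` for every `k` then `g ∈ J`
(`⋂ₖ (J + 𝔪^k) = J`, Hausdorffness of `T/J`). [cite: Matsumura1987, Thm. 8.10] -/
theorem mem_of_forall_mem_sup_pow {T : Type u} [CommRing T] [IsLocalRing T] [IsNoetherianRing T]
    (J : Ideal T) {g : T} (h : ∀ k : ℕ, g ∈ J ⊔ maximalIdeal T ^ k) : g ∈ J := by
  rw [← Ideal.Quotient.eq_zero_iff_mem]
  refine IsHausdorff.haus' (I := maximalIdeal T) _ fun k => ?_
  rw [SModEq.zero]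
  obtain ⟨j, hj, t, ht, hjt⟩ := Submodule.mem_sup.mp (h k)
  rw [← hjt, map_add, Ideal.Quotient.eq_zero_iff_mem.mpr hj, zero_add, Ideal.smul_top_eq_map,
    Submodule.restrictScalars_mem]
  exact Ideal.mem_map_of_mem (algebraMap T (T ⧸ J)) ht

/-! ### The limit of a steepening sequence in the completion -/

section Limit

variable {S : Type u} [CommRing S] [IsLocalRing S] [IsNoetherianRing S]

omit [IsNoetherianRing S] in
/-- Telescoping: `y_m - y_k ∈ 𝔪^k` for `k ≤ m` when `y_{j+1} - y_j ∈ 𝔪^{b_j}` with `b` strictly increasing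
(so `b_j ≥ j`). [folklore] -/
theorem sub_mem_maximalIdeal_pow_of_adicSteps (y : ℕ → S) {b : ℕ → ℕ} (hb : StrictMono b)
    (hstep : ∀ k, y (k + 1) - y k ∈ maximalIdeal S ^ b k) {k m : ℕ} (hkm : k ≤ m) :
    y m - y k ∈ maximalIdeal S ^ k := by
  induction m, hkm using Nat.le_induction with
  | base => rw [sub_self]; exact Ideal.zero_mem _
  | succ m hkm ih =>
    have h1 : y (m + 1) - y m ∈ maximalIdeal S ^ k :=
      Ideal.pow_le_pow_right (hkm.trans (hb.id_le m)) (hstep m)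
    have : y (m + 1) - y k = (y (m + 1) - y m) + (y m - y k) := by ring
    rw [this]
    exact Ideal.add_mem _ h1 ih

omit [IsNoetherianRing S] in
/-- A steepening step `y_{k+1} - y_k ∈ (x^{b_k})` with `x ∈ 𝔪` is an `𝔪`-adic step `∈ 𝔪^{b_k}`. [folklore] -/
theorem sub_mem_maximalIdeal_pow_of_mem_span_pow {x : S} (hx : x ∈ maximalIdeal S) (y : ℕ → S)
    {b : ℕ → ℕ} (hstep : ∀ k, y (k + 1) - y k ∈ Ideal.span {x ^ b k}) (k : ℕ) :
    y (k + 1) - y k ∈ maximalIdeal S ^ b k := by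
  obtain ⟨c, hc⟩ := Ideal.mem_span_singleton'.mp (hstep k)
  rw [← hc]
  exact Ideal.mul_mem_left _ _ (Ideal.pow_mem_pow hx (b k))

omit [IsNoetherianRing S] in
/-- `f ∈ (y^ν, x^b)` with `x ∈ 𝔪` implies `f ∈ (y^ν) + 𝔪^b`. [folklore] -/
theorem mem_span_sup_pow_of_mem_span_pair {x : S} (hx : x ∈ maximalIdeal S) {y f : S} {ν b : ℕ}
    (hf : f ∈ Ideal.span {y ^ ν, x ^ b}) : f ∈ Ideal.span {y ^ ν} ⊔ maximalIdeal S ^ b := by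
  obtain ⟨a, c, hac⟩ := Ideal.mem_span_pair.mp hf
  rw [← hac]
  exact Ideal.add_mem _ (Ideal.mem_sup_left (Ideal.mul_mem_left _ _ (Ideal.mem_span_singleton_self _)))
    (Ideal.mem_sup_right (Ideal.mul_mem_left _ _ (Ideal.pow_mem_pow hx b)))

/-- `𝔪_Ŝ^n ∩ S = 𝔪^n` (faithful flatness of `S → Ŝ` and `𝔪_Ŝ = 𝔪 Ŝ`). [cite: Matsumura1987, Thm. 8.14] -/
theorem comap_maximalIdeal_pow_adicCompletion (n : ℕ) :
    (maximalIdeal (AdicCompletion (maximalIdeal S) S) ^ n).comap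
        (algebraMap S (AdicCompletion (maximalIdeal S) S)) = maximalIdeal S ^ n := by
  rw [AdicCompletion.maximalIdeal_eq_map, ← Ideal.map_pow, Ideal.comap_map_eq_self_of_faithfullyFlat]

/-- A sequence `y` with `y_m - y_k ∈ 𝔪^k` (`k ≤ m`) has a limit `ŷ` in the completion `Ŝ`, with
`ŷ - y_k ∈ 𝔪_Ŝ^k` for every `k`. [cite: Matsumura1987, §8 (completion)] -/
theorem exists_limit (y : ℕ → S) (hy : ∀ {k m : ℕ}, k ≤ m → y m - y k ∈ maximalIdeal S ^ k) :
    ∃ ŷ : AdicCompletion (maximalIdeal S) S, ∀ k : ℕ,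
      ŷ - algebraMap S (AdicCompletion (maximalIdeal S) S) (y k) ∈
        maximalIdeal (AdicCompletion (maximalIdeal S) S) ^ k := by
  let c : AdicCompletion.AdicCauchySequence (maximalIdeal S) S :=
    ⟨y, fun {k m} hkm => by
      rw [SModEq.sub_mem, smul_eq_mul, Ideal.mul_top, ← neg_sub, neg_mem_iff]
      exact hy hkm⟩
  refine ⟨AdicCompletion.mk (maximalIdeal S) S c, fun k => ?_⟩
  have hfg : (maximalIdeal S).FG := IsNoetherian.noetherian _
  have hker : AdicCompletion.mk (maximalIdeal S) S c -
      algebraMap S (AdicCompletion (maximalIdeal S) S) (y k) ∈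
        LinearMap.ker (AdicCompletion.eval (maximalIdeal S) S k) := by
    rw [LinearMap.mem_ker, map_sub, sub_eq_zero, AdicCompletion.algebraMap_apply,
      Algebra.algebraMap_self, RingHom.id_apply]
    rfl
  rw [← AdicCompletion.pow_smul_top_eq_ker_eval hfg, Ideal.smul_top_eq_map,
    Submodule.restrictScalars_mem, Ideal.map_pow, ← AdicCompletion.maximalIdeal_eq_map] at hker
  exact hker

/-- The limit of an `𝔪`-adic steepening sequence `y_{k+1} - y_k ∈ 𝔪^{b_k}` (`b` strictly increasing,
`y_k ∈ 𝔪 ∖ 𝔪²`): an element `ŷ ∈ 𝔪_Ŝ ∖ 𝔪_Ŝ²` with `ŷ - y_k ∈ 𝔪_Ŝ^k` for all `k`. [folklore] -/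
theorem exists_limit_of_steepening (y : ℕ → S)
    (hy : ∀ k, y k ∈ maximalIdeal S) (hy2 : ∀ k, y k ∉ maximalIdeal S ^ 2) {b : ℕ → ℕ}
    (hb : StrictMono b) (hstep : ∀ k, y (k + 1) - y k ∈ maximalIdeal S ^ b k) :
    ∃ ŷ : AdicCompletion (maximalIdeal S) S,
      ŷ ∈ maximalIdeal (AdicCompletion (maximalIdeal S) S) ∧
      ŷ ∉ maximalIdeal (AdicCompletion (maximalIdeal S) S) ^ 2 ∧
      ∀ k : ℕ, ŷ - algebraMap S (AdicCompletion (maximalIdeal S) S) (y k) ∈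
        maximalIdeal (AdicCompletion (maximalIdeal S) S) ^ k := by
  obtain ⟨ŷ, hŷ⟩ := exists_limit y (fun hkm => sub_mem_maximalIdeal_pow_of_adicSteps y hb hstep hkm)
  have hmapmem : ∀ k, algebraMap S (AdicCompletion (maximalIdeal S) S) (y k) ∈
      maximalIdeal (AdicCompletion (maximalIdeal S) S) := fun k => by
    rw [AdicCompletion.maximalIdeal_eq_map]
    exact Ideal.mem_map_of_mem _ (hy k)
  refine ⟨ŷ, ?_, ?_, hŷ⟩
  · have h1 := hŷ 1
    rw [pow_one] at h1
    have : ŷ = (ŷ - algebraMap S _ (y 1)) + algebraMap S _ (y 1) := by ring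
    rw [this]
    exact Ideal.add_mem _ h1 (hmapmem 1)
  · intro h2
    apply hy2 2
    have h := hŷ 2
    have hmem : algebraMap S (AdicCompletion (maximalIdeal S) S) (y 2) ∈
        maximalIdeal (AdicCompletion (maximalIdeal S) S) ^ 2 := by
      have : algebraMap S (AdicCompletion (maximalIdeal S) S) (y 2) =
          ŷ - (ŷ - algebraMap S _ (y 2)) := by ring
      rw [this]
      exact Ideal.sub_mem _ h2 h
    rw [← comap_maximalIdeal_pow_adicCompletion (S := S) 2, Ideal.mem_comap]
    exact hmem

end Limit

/-! ### Termination of steepening -/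

section Main

variable {S : Type u} [CommRing S] [IsRegularLocalRing S]

/-- A prime ideal containing a non-zero element of a UFD contains one of its prime factors. [folklore] -/
theorem exists_prime_dvd_mem_of_mem {R : Type u} [CommRing R] [IsDomain R] [UniqueFactorizationMonoid R]
    {Q : Ideal R} (hQ : Q.IsPrime) {f : R} (hf0 : f ≠ 0) (hfQ : f ∈ Q) :
    ∃ π : R, Prime π ∧ π ∣ f ∧ π ∈ Q := by
  classical
  obtain ⟨u, hu⟩ := UniqueFactorizationMonoid.factors_prod hf0
  have hprod : (UniqueFactorizationMonoid.factors f).prod ∈ Q := by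
    have h : (UniqueFactorizationMonoid.factors f).prod * u ∈ Q := by rw [hu]; exact hfQ
    exact (hQ.mem_or_mem h).resolve_right fun h' => hQ.ne_top (Ideal.eq_top_of_isUnit_mem _ h' u.isUnit)
  obtain ⟨π, hπ, hπQ⟩ := (hQ.multiset_prod_mem_iff_exists_mem _).mp hprod
  exact ⟨π, UniqueFactorizationMonoid.prime_of_factor π hπ,
    UniqueFactorizationMonoid.dvd_of_mem_factors hπ, hπQ⟩

/-- **K6 / L∞ — termination of steepening, `𝔪`-adic form** (res-type-098 EFT-DIM2-DESIGN v1 §3, K5-free,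
every dimension; wish (w2) of res-type-098 2026-08-27T06:26:38Z): in an excellent regular local ring `S`, let
`y_k ∈ 𝔪 ∖ 𝔪²` with `y_{k+1} - y_k ∈ 𝔪^{b_k}`, `b` strictly increasing; if `1 ≤ ν`, `f ∉ 𝔪^{ν+1}` and
`f ∈ (y_k^ν) + 𝔪^{b_k}` for every `k`, then `f` is a unit times `π^ν` for some `π ∈ 𝔪 ∖ 𝔪²`.
[OURS · L1 W4.3 · (o13) kernel K6] [cite: Matsumura1987, Thm. 8.11, Thm. 20.3, §32] -/
theorem exists_associated_pow_of_adicSteepening (hS : IsExcellentRing S)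
    (y : ℕ → S) (hy : ∀ k, y k ∈ maximalIdeal S) (hy2 : ∀ k, y k ∉ maximalIdeal S ^ 2)
    {b : ℕ → ℕ} (hb : StrictMono b) (hstep : ∀ k, y (k + 1) - y k ∈ maximalIdeal S ^ b k)
    {f : S} {ν : ℕ} (hν : 1 ≤ ν) (hford : f ∉ maximalIdeal S ^ (ν + 1))
    (hf : ∀ k, f ∈ Ideal.span {y k ^ ν} ⊔ maximalIdeal S ^ b k) :
    ∃ π : S, π ∈ maximalIdeal S ∧ π ∉ maximalIdeal S ^ 2 ∧ Associated f (π ^ ν) := by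
  -- notation
  haveI : IsDomain S := isDomain_of_isRegularLocalRing S
  haveI : UniqueFactorizationMonoid S := uniqueFactorizationMonoid_of_isRegularLocalRing S ‹_›
  haveI hŜreg : IsRegularLocalRing (AdicCompletion (maximalIdeal S) S) :=
    isRegularLocalRing_adicCompletion S
  have hφmem : ∀ {s : S}, s ∈ maximalIdeal S →
      algebraMap S (AdicCompletion (maximalIdeal S) S) s ∈
        maximalIdeal (AdicCompletion (maximalIdeal S) S) := fun hs => by
    rw [AdicCompletion.maximalIdeal_eq_map]
    exact Ideal.mem_map_of_mem _ hs
  have hcomap : ∀ n : ℕ, (maximalIdeal (AdicCompletion (maximalIdeal S) S) ^ n).comap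
      (algebraMap S (AdicCompletion (maximalIdeal S) S)) = maximalIdeal S ^ n :=
    fun n => comap_maximalIdeal_pow_adicCompletion (S := S) n
  set T := AdicCompletion (maximalIdeal S) S
  set φ : S →+* T := algebraMap S T
  have hf0 : f ≠ 0 := by rintro rfl; exact hford (Ideal.zero_mem _)
  -- Step 1: the limit `ŷ`
  obtain ⟨ŷ, hŷm, hŷ2, hŷ⟩ := exists_limit_of_steepening y hy hy2 hb hstep
  -- Step 2: `φ f ∈ (ŷ^ν) + 𝔪_T^k` for every `k`
  have hstepT : ∀ k : ℕ, φ f ∈ Ideal.span {ŷ ^ ν} ⊔ maximalIdeal T ^ k := by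
    intro k
    obtain ⟨a', ha', t, ht, hat⟩ := Submodule.mem_sup.mp (hf k)
    obtain ⟨a, rfl⟩ := Ideal.mem_span_singleton'.mp ha'
    -- `φ (y k) ^ ν - ŷ ^ ν ∈ 𝔪_T ^ k`
    have hd : φ (y k) - ŷ ∈ maximalIdeal T ^ k := by
      rw [← neg_sub, neg_mem_iff]
      exact hŷ k
    have hpow : φ (y k) ^ ν - ŷ ^ ν ∈ maximalIdeal T ^ k := by
      obtain ⟨d, hdd⟩ := sub_dvd_pow_sub_pow (φ (y k)) ŷ ν
      rw [hdd]
      exact Ideal.mul_mem_right _ _ hd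
    have htk : φ t ∈ maximalIdeal T ^ k := by
      refine Ideal.pow_le_pow_right (hb.id_le k) ?_
      rw [← hcomap (b k), Ideal.mem_comap] at ht
      exact ht
    have : φ f = φ a * ŷ ^ ν + (φ a * (φ (y k) ^ ν - ŷ ^ ν) + φ t) := by
      rw [← hat, map_add, map_mul, map_pow]
      ring
    rw [this]
    refine Ideal.add_mem _ (Ideal.mem_sup_left (Ideal.mul_mem_left _ _ (Ideal.mem_span_singleton_self _)))
      (Ideal.mem_sup_right (Ideal.add_mem _ (Ideal.mul_mem_left _ _ hpow) htk))
  -- Step 3: `φ f = a • ŷ^ν` with `a` a unit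
  have hmem : φ f ∈ Ideal.span {ŷ ^ ν} := mem_of_forall_mem_sup_pow _ hstepT
  obtain ⟨a, ha⟩ := Ideal.mem_span_singleton'.mp hmem
  have haunit : IsUnit a := by
    by_contra hna
    have ham : a ∈ maximalIdeal T := (IsLocalRing.mem_maximalIdeal _).mpr hna
    have : φ f ∈ maximalIdeal T ^ (ν + 1) := by
      rw [← ha, pow_succ', ]
      exact Ideal.mul_mem_mul ham (Ideal.pow_mem_pow hŷm ν)
    apply hford
    rw [← hcomap (ν + 1), Ideal.mem_comap]
    exact this
  have hspanf : Ideal.span {φ f} = Ideal.span {ŷ ^ ν} := by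
    rw [← ha]
    exact Ideal.span_singleton_mul_left_unit haunit _
  -- Step 4: `ŷ` is prime in `T`; the prime `Q = ŷT ∩ S ∋ f` contains a prime factor `π` of `f`
  have hŷprime : Prime ŷ := IsRegularLocalRing.prime_of_not_mem_sq hŷm hŷ2
  haveI hŷideal : (Ideal.span {ŷ}).IsPrime :=
    (Ideal.span_singleton_prime hŷprime.ne_zero).mpr hŷprime
  have hfQ : f ∈ (Ideal.span {ŷ}).comap φ := by
    rw [Ideal.mem_comap, ← ha]
    refine Ideal.mul_mem_left _ _ (Ideal.pow_mem_of_mem _ (Ideal.mem_span_singleton_self _) ν hν)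
  obtain ⟨π, hπprime, hπdvd, hπQ⟩ :=
    exists_prime_dvd_mem_of_mem (Ideal.comap_isPrime φ (Ideal.span {ŷ})) hf0 hfQ
  rw [Ideal.mem_comap, Ideal.mem_span_singleton] at hπQ
  -- Step 5: `π T` is a radical ideal (excellence: `T/πT ≅ (S/(π))^` is reduced)
  have hrad : (Ideal.span {φ π}).IsRadical := by
    have hmapπ : (Ideal.span {π}).map φ = Ideal.span {φ π} := by
      rw [Ideal.map_span, Set.image_singleton]
    rw [← hmapπ, Ideal.isRadical_iff_quotient_reduced]
    haveI : (Ideal.span {π}).IsPrime := (Ideal.span_singleton_prime hπprime.ne_zero).mpr hπprime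
    haveI : IsDomain (S ⧸ Ideal.span {π}) := Ideal.Quotient.isDomain _
    haveI : IsLocalRing (S ⧸ Ideal.span {π}) :=
      IsLocalRing.of_surjective' (Ideal.Quotient.mk _) Ideal.Quotient.mk_surjective
    have hexc : IsExcellentRing (S ⧸ Ideal.span {π}) :=
      hS.of_surjective (Ideal.Quotient.mk _) Ideal.Quotient.mk_surjective
    have hred : IsReduced (AdicCompletion (maximalIdeal (S ⧸ Ideal.span {π})) (S ⧸ Ideal.span {π})) :=
      hexc.isReduced_adicCompletion
    have hmax : (maximalIdeal S).map (Ideal.Quotient.mk (Ideal.span {π})) =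
        maximalIdeal (S ⧸ Ideal.span {π}) :=
      IsLocalRing.map_maximalIdeal_of_surjective _ Ideal.Quotient.mk_surjective
    rw [← hmax] at hred
    exact isReduced_of_injective (quotientCompletionEquiv (maximalIdeal S) (Ideal.span {π}))
      (quotientCompletionEquiv (maximalIdeal S) (Ideal.span {π})).injective
  -- Step 6: `π T = ŷ T`
  have hŷπ : ŷ ∈ Ideal.span {φ π} := by
    refine hrad ⟨ν, ?_⟩
    have : ŷ ^ ν ∈ Ideal.span {φ f} := by
      rw [hspanf]
      exact Ideal.mem_span_singleton_self _
    refine (Ideal.span_singleton_le_iff_mem _).mpr ?_ this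
    exact Ideal.mem_span_singleton.mpr (map_dvd φ hπdvd)
  have hspanπ : Ideal.span {φ π} = Ideal.span {ŷ} :=
    le_antisymm ((Ideal.span_singleton_le_iff_mem _).mpr (Ideal.mem_span_singleton.mpr hπQ))
      ((Ideal.span_singleton_le_iff_mem _).mpr hŷπ)
  -- Step 7: conclusions
  refine ⟨π, (IsLocalRing.mem_maximalIdeal _).mpr hπprime.not_unit, ?_, ?_⟩
  · intro hπ2
    apply hŷ2
    have h1 : φ π ∈ maximalIdeal T ^ 2 := by
      rw [← hcomap 2, Ideal.mem_comap] at hπ2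
      exact hπ2
    exact (Ideal.span_singleton_le_iff_mem _).mpr h1 (hspanπ ▸ Ideal.mem_span_singleton_self ŷ)
  · have hmapS : (Ideal.span {f}).map φ = (Ideal.span {π ^ ν}).map φ := by
      rw [Ideal.map_span, Set.image_singleton, Ideal.map_span, Set.image_singleton, hspanf,
        ← Ideal.span_singleton_pow, ← hspanπ, Ideal.span_singleton_pow, map_pow]
    have := congrArg (Ideal.comap φ) hmapS
    rw [Ideal.comap_map_eq_self_of_faithfullyFlat, Ideal.comap_map_eq_self_of_faithfullyFlat] at this
    exact Ideal.span_singleton_eq_span_singleton.mp this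

/-- **K6 / L∞ — termination of steepening** (res-type-098 EFT-DIM2-DESIGN v1 §3, K5-free form, every
dimension; the signature announced 2026-08-27T06:16:12Z and accepted by res-type-098 06:26:38Z): in an
excellent regular local ring `S`, let `x ∈ 𝔪`, `y_k ∈ 𝔪 ∖ 𝔪²` with `y_{k+1} - y_k ∈ (x^{b_k})`, `b` strictly
increasing; if `1 ≤ ν`, `f ∉ 𝔪^{ν+1}` and `f ∈ (y_k^ν, x^{b_k})` for every `k`, then `f` is a unit times `π^ν`
for some `π ∈ 𝔪 ∖ 𝔪²`.  [OURS · L1 W4.3 · (o13) kernel K6] [cite: Matsumura1987, Thm. 8.11, Thm. 20.3, §32] -/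
theorem exists_associated_pow_of_steepening (hS : IsExcellentRing S) {x : S} (hx : x ∈ maximalIdeal S)
    (y : ℕ → S) (hy : ∀ k, y k ∈ maximalIdeal S) (hy2 : ∀ k, y k ∉ maximalIdeal S ^ 2)
    {b : ℕ → ℕ} (hb : StrictMono b) (hstep : ∀ k, y (k + 1) - y k ∈ Ideal.span {x ^ b k})
    {f : S} {ν : ℕ} (hν : 1 ≤ ν) (hford : f ∉ maximalIdeal S ^ (ν + 1))
    (hf : ∀ k, f ∈ Ideal.span {y k ^ ν, x ^ b k}) :
    ∃ π : S, π ∈ maximalIdeal S ∧ π ∉ maximalIdeal S ^ 2 ∧ Associated f (π ^ ν) :=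
  exists_associated_pow_of_adicSteepening hS y hy hy2 hb
    (sub_mem_maximalIdeal_pow_of_mem_span_pow hx y hstep) hν hford
    (fun k => mem_span_sup_pow_of_mem_span_pair hx (hf k))

/-- K6 in the MEMBERSHIP form `f ∈ (π^ν)` (wish (w1) of res-type-098 2026-08-27T06:26:38Z; the element
`π ∈ 𝔪 ∖ 𝔪²` is a regular parameter, so with `ν ≥ 2` this is case A «`π² ∣ f`» of the dim-2 move table).
[OURS · L1 W4.3 · (o13) kernel K6] [cite: Matsumura1987, Thm. 8.11, Thm. 20.3, §32] -/
theorem exists_mem_span_pow_of_steepening (hS : IsExcellentRing S) {x : S} (hx : x ∈ maximalIdeal S)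
    (y : ℕ → S) (hy : ∀ k, y k ∈ maximalIdeal S) (hy2 : ∀ k, y k ∉ maximalIdeal S ^ 2)
    {b : ℕ → ℕ} (hb : StrictMono b) (hstep : ∀ k, y (k + 1) - y k ∈ Ideal.span {x ^ b k})
    {f : S} {ν : ℕ} (hν : 1 ≤ ν) (hford : f ∉ maximalIdeal S ^ (ν + 1))
    (hf : ∀ k, f ∈ Ideal.span {y k ^ ν, x ^ b k}) :
    ∃ π : S, π ∈ maximalIdeal S ∧ π ∉ maximalIdeal S ^ 2 ∧ f ∈ Ideal.span {π ^ ν} := by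
  obtain ⟨π, hπ, hπ2, hass⟩ := exists_associated_pow_of_steepening hS hx y hy hy2 hb hstep hν hford hf
  refine ⟨π, hπ, hπ2, ?_⟩
  obtain ⟨u, hu⟩ := hass.symm
  rw [← hu]
  exact Ideal.mul_mem_right _ _ (Ideal.mem_span_singleton_self _)

/-- K6, `𝔪`-adic form, in the DIVISIBILITY shape `π ^ ν ∣ f` (equivalently `f ∈ (π^ν)`). [OURS · L1 W4.3 ·
(o13) kernel K6] [cite: Matsumura1987, Thm. 8.11, Thm. 20.3, §32] -/
theorem exists_pow_dvd_of_adicSteepening (hS : IsExcellentRing S)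
    (y : ℕ → S) (hy : ∀ k, y k ∈ maximalIdeal S) (hy2 : ∀ k, y k ∉ maximalIdeal S ^ 2)
    {b : ℕ → ℕ} (hb : StrictMono b) (hstep : ∀ k, y (k + 1) - y k ∈ maximalIdeal S ^ b k)
    {f : S} {ν : ℕ} (hν : 1 ≤ ν) (hford : f ∉ maximalIdeal S ^ (ν + 1))
    (hf : ∀ k, f ∈ Ideal.span {y k ^ ν} ⊔ maximalIdeal S ^ b k) :
    ∃ π : S, π ∈ maximalIdeal S ∧ π ∉ maximalIdeal S ^ 2 ∧ π ^ ν ∣ f := by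
  obtain ⟨π, hπ, hπ2, hass⟩ := exists_associated_pow_of_adicSteepening hS y hy hy2 hb hstep hν hford hf
  exact ⟨π, hπ, hπ2, hass.symm.dvd⟩

/-- **K6 for local rings essentially of finite type over a field** (the binder of the door's H2a′/H2a‴
positions; such rings are excellent, tree `IsExcellentRing.of_essFiniteType`). [OURS · L1 W4.3 · (o13) K6]
[cite: Matsumura1987, §32] -/
theorem exists_associated_pow_of_steepening_of_essFiniteType (k₀ : Type u) [Field k₀] [Algebra k₀ S]
    [Algebra.EssFiniteType k₀ S] {x : S} (hx : x ∈ maximalIdeal S)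
    (y : ℕ → S) (hy : ∀ k, y k ∈ maximalIdeal S) (hy2 : ∀ k, y k ∉ maximalIdeal S ^ 2)
    {b : ℕ → ℕ} (hb : StrictMono b) (hstep : ∀ k, y (k + 1) - y k ∈ Ideal.span {x ^ b k})
    {f : S} {ν : ℕ} (hν : 1 ≤ ν) (hford : f ∉ maximalIdeal S ^ (ν + 1))
    (hf : ∀ k, f ∈ Ideal.span {y k ^ ν, x ^ b k}) :
    ∃ π : S, π ∈ maximalIdeal S ∧ π ∉ maximalIdeal S ^ 2 ∧ Associated f (π ^ ν) :=
  have hk : IsExcellentRing k₀ := Stacks07QW_field_holds k₀ k₀ inferInstance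
  exists_associated_pow_of_steepening (hk.of_essFiniteType ‹_›) hx y hy hy2 hb hstep hν hford hf

end Main

end LocalGameEFTContact

end Summit.ResolutionOfSingularities.ResolutionOfSingularities.Theorems

end
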